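import Summits.QuantumFields.YangMills.Theorems.AllWindowsColdBoxBoxHighLineRestrictionSetCrossParityReduce

/-!
# U5 K3′: the «sup × L² × L²» bound for `κ₃,₀^{μ_{D′}}` in Gaussian letters (rows RC, RD, RE of the K3′ term table)

Free-hands helper of the κ-lineage (ym-line-fcl-p3 g27); K3′ term table of record = HOME bus 2026-08-30T01:19:30Z (adopted by planner ym-idea-2 g18 01:19:49Z).
Over `μ_D := (volume.restrict D).withDensity (ofReal ∘ gaussWeight β H)`, `D` measurable with `E₀[1 − 1_D] ≤ τ ≤ 1/2`, for observables measurable and bounded by `B`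
on `D` and ONE factor sup-small (`≤ S` on `D`):

* `abs_tiltExp_muSet_zero_centred3_le_of_sup` — core: `|E_0[(F−E_0F)(G−E_0G)(Z−E_0Z)]| ≤ 2S·√(2E₀[1_D(G−b)²])·√(2E₀[1_D(Z−c)²])` for ANY centring constants
  `b, c` (Cauchy–Schwarz ✓`abs_tiltExp_muSet_zero_pair_le`, variance minimality ✓`tiltExp_muSet_zero_centredSq_le`, `μ_D ≤ 2·E₀` on nonnegative integrands
  ✓`tiltExp_muSet_zero_le_two_mul_gaussAvg`);
* ★ `abs_tiltCum3_muSet_zero_le_of_sup_left` — `|κ₃,₀^{μ_D}(F, G; W)| ≤ 2S·√(2E₀[1_D(G−b)²])·√(2E₀[1_D(W−c)²])` when `sup_D|F| ≤ S` (rows RD: `F = c^{odd} − tripleForm T₀`,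
  `S = C₀s⁵`; RE: `F = c − ℓ² − c^{odd}`, `S = 42s⁴`);
* ★ `abs_tiltCum3_muSet_zero_le_of_sup_third` — `|κ₃,₀^{μ_D}(F, G; W)| ≤ 2S·√(2E₀[1_D(F−a)²])·√(2E₀[1_D(G−b)²])` when `sup_D|W| ≤ S` (row RC: `W = N = Uᵒ − P`, `S = ν`).

No definitions; standard axioms.  HONEST LABEL: helper-grade U5 prep; U5, ⟨24004⟩, ⟨24336⟩ remain OPEN; route AllWindowsColdBox is DRAFT; no crux, rung or summit is proved;
**the Yang–Mills mass gap is NOT proved by this file; no summit is proved by a line.**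
-/

set_option autoImplicit false

noncomputable section

open MeasureTheory Set

namespace Summit.QuantumFields.YangMills.Theorems.AllWindowsColdBoxBoxHighLine

namespace GaussRestrict

variable {H : ℕ} {β : ℝ}

/-- Core «sup × L² × L²» bound: `|E_0[(F−E_0F)(G−E_0G)(Z−E_0Z)]| ≤ 2S·√(2E₀[1_D(G−b)²])·√(2E₀[1_D(Z−c)²])` (`sup_D|F| ≤ S`; any tilt letter `V` at `t = 0`). -/
theorem abs_tiltExp_muSet_zero_centred3_le_of_sup (hβ : 0 < β) {D : Set (LandauFree H → E3)} (hDm : MeasurableSet D) {τ : ℝ}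
    (hτ : gaussAvg β H (fun a => 1 - D.indicator (fun _ => (1 : ℝ)) a) ≤ τ) (hτ2 : τ ≤ 1 / 2) (V : (LandauFree H → E3) → ℝ)
    {F G Z : (LandauFree H → E3) → ℝ} {B S : ℝ} (hB : 0 ≤ B) (hS : 0 ≤ S) (mF : Measurable F) (mG : Measurable G) (mZ : Measurable Z)
    (bF : ∀ a ∈ D, |F a| ≤ B) (bG : ∀ a ∈ D, |G a| ≤ B) (bZ : ∀ a ∈ D, |Z a| ≤ B) (sF : ∀ a ∈ D, |F a| ≤ S) (b c : ℝ) :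
    let μD : Measure (LandauFree H → E3) := (((volume : Measure (LandauFree H → E3)).restrict D).withDensity fun a => ENNReal.ofReal (gaussWeight β H a))
    let E : ((LandauFree H → E3) → ℝ) → ℝ := fun X => Tilt.tiltExp μD V 0 X
    |E (fun a => (F a - E F) * (G a - E G) * (Z a - E Z))| ≤
      2 * S * Real.sqrt (2 * gaussAvg β H (fun a => D.indicator (fun _ => (1 : ℝ)) a * (G a - b) ^ 2)) *
        Real.sqrt (2 * gaussAvg β H (fun a => D.indicator (fun _ => (1 : ℝ)) a * (Z a - c) ^ 2)) := by
  intro μD E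
  have hD := integral_indicator_mul_gaussWeight_pos hβ hDm hτ hτ2
  set cF := E F with hcF
  set cG := E G with hcG
  set cZ := E Z with hcZ
  -- bounds on `D`
  have bcF : |cF| ≤ S := abs_tiltExp_muSet_zero_le hβ hDm hD V hS sF
  have bcFB : |cF| ≤ B := abs_tiltExp_muSet_zero_le hβ hDm hD V hB bF
  have bcG : |cG| ≤ B := abs_tiltExp_muSet_zero_le hβ hDm hD V hB bG
  have bcZ : |cZ| ≤ B := abs_tiltExp_muSet_zero_le hβ hDm hD V hB bZ
  have dFS : ∀ a ∈ D, |F a - cF| ≤ 2 * S := fun a ha => (abs_sub _ _).trans (by linarith only [sF a ha, bcF])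
  have hB1 : 1 ≤ 2 * B + 1 := by linarith only [hB]
  have hB0' : 0 ≤ 2 * B + 1 := by linarith only [hB]
  have dF : ∀ a ∈ D, |F a - cF| ≤ 2 * B + 1 := fun a ha => (abs_sub _ _).trans (by linarith only [bF a ha, bcFB])
  have dG : ∀ a ∈ D, |G a - cG| ≤ 2 * B + 1 := fun a ha => (abs_sub _ _).trans (by linarith only [bG a ha, bcG])
  have dZ : ∀ a ∈ D, |Z a - cZ| ≤ 2 * B + 1 := fun a ha => (abs_sub _ _).trans (by linarith only [bZ a ha, bcZ])
  set K : ℝ := (2 * B + 1) ^ 2 with hK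
  have hK0 : 0 ≤ K := sq_nonneg _
  have hK1 : 2 * B + 1 ≤ K := by rw [hK]; nlinarith only [hB1]
  have dP : ∀ a ∈ D, |(F a - cF) * (G a - cG)| ≤ K := fun a ha => by
    rw [abs_mul, hK, sq]; exact mul_le_mul (dF a ha) (dG a ha) (abs_nonneg _) hB0'
  have dZK : ∀ a ∈ D, |Z a - cZ| ≤ K := fun a ha => (dZ a ha).trans hK1
  have dGb : ∀ a ∈ D, |G a - b| ≤ B + |b| := fun a ha => (abs_sub _ _).trans (add_le_add (bG a ha) le_rfl)
  have dZc : ∀ a ∈ D, |Z a - c| ≤ B + |c| := fun a ha => (abs_sub _ _).trans (add_le_add (bZ a ha) le_rfl)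
  -- measurability
  have mP : Measurable fun a => (F a - cF) * (G a - cG) := (mF.sub measurable_const).mul (mG.sub measurable_const)
  have mQ : Measurable fun a => Z a - cZ := mZ.sub measurable_const
  have mcG : Measurable fun a => G a - cG := mG.sub measurable_const
  -- Cauchy–Schwarz
  have cs := abs_tiltExp_muSet_zero_pair_le (β := β) hDm V hK0 mP mQ dP dZK
  -- the sup on the first factor
  have nS2 : 0 ≤ (2 * S) ^ 2 := sq_nonneg _
  have mono : Tilt.tiltExp μD V 0 (fun a => ((F a - cF) * (G a - cG)) ^ 2) ≤ Tilt.tiltExp μD V 0 (fun a => (2 * S) ^ 2 * (G a - cG) ^ 2) := by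
    refine tiltExp_muSet_zero_mono_on hβ hDm hD V (B := K ^ 2 + (2 * S) ^ 2 * K ^ 2) (by positivity) (mP.pow_const 2) ((mcG.pow_const 2).const_mul _)
      (fun a ha => ?_) (fun a ha => ?_) (fun a ha => ?_)
    · rw [abs_pow]
      have h1 := pow_le_pow_left₀ (abs_nonneg _) (dP a ha) 2
      nlinarith only [h1, nS2, sq_nonneg K]
    · rw [abs_mul, abs_pow, abs_pow, abs_of_nonneg (by linarith only [hS] : (0 : ℝ) ≤ 2 * S)]
      have h1 := pow_le_pow_left₀ (abs_nonneg _) ((dG a ha).trans hK1) 2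
      have h2 := mul_le_mul_of_nonneg_left h1 nS2
      nlinarith only [h2, sq_nonneg K]
    · rw [show ((F a - cF) * (G a - cG)) ^ 2 = (F a - cF) ^ 2 * (G a - cG) ^ 2 by ring]
      refine mul_le_mul_of_nonneg_right ?_ (sq_nonneg _)
      have h := pow_le_pow_left₀ (abs_nonneg _) (dFS a ha) 2
      rwa [sq_abs] at h
  rw [Tilt.tiltExp_const_mul] at mono
  -- Gaussian letters
  have mI : Measurable (D.indicator (fun _ => (1 : ℝ))) := measurable_const.indicator hDm
  have gauss : ∀ {X : (LandauFree H → E3) → ℝ} {C : ℝ}, Measurable X → (∀ a ∈ D, |X a| ≤ C) →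
      Tilt.tiltExp μD V 0 (fun a => X a ^ 2) ≤ 2 * gaussAvg β H (fun a => D.indicator (fun _ => (1 : ℝ)) a * X a ^ 2) := by
    intro X C mX bX
    have eX : ∀ a ∈ D, X a ^ 2 = D.indicator (fun _ => (1 : ℝ)) a * X a ^ 2 := fun a ha => by rw [Set.indicator_of_mem ha, one_mul]
    rw [tiltExp_muSet_congr_on β hDm V 0 eX]
    have h0 : 0 ≤ fun a => D.indicator (fun _ => (1 : ℝ)) a * X a ^ 2 := fun a => mul_nonneg (indicator_one_nonneg_le_one D a).1 (sq_nonneg _)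
    have hI : Integrable fun a => D.indicator (fun _ => (1 : ℝ)) a * X a ^ 2 * gaussWeight β H a := by
      refine Tilt.integrable_bdd_mul_gaussWeight H hβ (mI.mul (mX.pow_const _)) (C := (max C 0) ^ 2) fun a => ?_
      by_cases ha : a ∈ D
      · rw [Set.indicator_of_mem ha, one_mul, abs_pow]; exact pow_le_pow_left₀ (abs_nonneg _) ((bX a ha).trans (le_max_left _ _)) _
      · rw [Set.indicator_of_notMem ha, zero_mul, abs_zero]; exact pow_nonneg (le_max_right _ _) _
    exact tiltExp_muSet_zero_le_two_mul_gaussAvg hβ hDm hτ hτ2 V h0 hI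
  have vG := ((tiltExp_muSet_zero_centredSq_le hβ hDm hD V hB mG bG b).trans (gauss (mG.sub measurable_const) dGb))
  have vZ := ((tiltExp_muSet_zero_centredSq_le hβ hDm hD V hB mZ bZ c).trans (gauss (mZ.sub measurable_const) dZc))
  -- assemble
  have nS : 0 ≤ 2 * S := by linarith only [hS]
  have h1 : Real.sqrt (Tilt.tiltExp μD V 0 (fun a => ((F a - cF) * (G a - cG)) ^ 2)) ≤
      2 * S * Real.sqrt (2 * gaussAvg β H (fun a => D.indicator (fun _ => (1 : ℝ)) a * (G a - b) ^ 2)) := by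
    have h := Real.sqrt_le_sqrt (mono.trans (mul_le_mul_of_nonneg_left vG nS2))
    rwa [Real.sqrt_mul nS2, Real.sqrt_sq nS] at h
  have h2 : Real.sqrt (Tilt.tiltExp μD V 0 (fun a => (Z a - cZ) ^ 2)) ≤
      Real.sqrt (2 * gaussAvg β H (fun a => D.indicator (fun _ => (1 : ℝ)) a * (Z a - c) ^ 2)) := Real.sqrt_le_sqrt vZ
  exact cs.trans (mul_le_mul h1 h2 (Real.sqrt_nonneg _) (by positivity))

/-- ★ **Row tool (RD, RE): sup on the FIRST slot.**  `|κ₃,₀^{μ_D}(F, G; W)| ≤ 2S·√(2E₀[1_D(G−b)²])·√(2E₀[1_D(W−c)²])` when `sup_D|F| ≤ S`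
(`F, G, W` measurable, bounded by `B` on `D`; any centring constants `b, c`). -/
theorem abs_tiltCum3_muSet_zero_le_of_sup_left (hβ : 0 < β) {D : Set (LandauFree H → E3)} (hDm : MeasurableSet D) {τ : ℝ}
    (hτ : gaussAvg β H (fun a => 1 - D.indicator (fun _ => (1 : ℝ)) a) ≤ τ) (hτ2 : τ ≤ 1 / 2) (W : (LandauFree H → E3) → ℝ)
    {F G : (LandauFree H → E3) → ℝ} {B S : ℝ} (hB : 0 ≤ B) (hS : 0 ≤ S) (mF : Measurable F) (mG : Measurable G) (mW : Measurable W)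
    (bF : ∀ a ∈ D, |F a| ≤ B) (bG : ∀ a ∈ D, |G a| ≤ B) (bW : ∀ a ∈ D, |W a| ≤ B) (sF : ∀ a ∈ D, |F a| ≤ S) (b c : ℝ) :
    |Tilt.tiltCum3 ((((volume : Measure (LandauFree H → E3)).restrict D).withDensity fun a => ENNReal.ofReal (gaussWeight β H a))) W 0 F G| ≤
      2 * S * Real.sqrt (2 * gaussAvg β H (fun a => D.indicator (fun _ => (1 : ℝ)) a * (G a - b) ^ 2)) *
        Real.sqrt (2 * gaussAvg β H (fun a => D.indicator (fun _ => (1 : ℝ)) a * (W a - c) ^ 2)) := by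
  rw [tiltCum3_zero_eq_triple _ W W F G]
  exact abs_tiltExp_muSet_zero_centred3_le_of_sup hβ hDm hτ hτ2 W hB hS mF mG mW bF bG bW sF b c

/-- ★ **Row tool (RC): sup on the TILT slot.**  `|κ₃,₀^{μ_D}(F, G; W)| ≤ 2S·√(2E₀[1_D(F−a₁)²])·√(2E₀[1_D(G−b)²])` when `sup_D|W| ≤ S`. -/
theorem abs_tiltCum3_muSet_zero_le_of_sup_third (hβ : 0 < β) {D : Set (LandauFree H → E3)} (hDm : MeasurableSet D) {τ : ℝ}
    (hτ : gaussAvg β H (fun a => 1 - D.indicator (fun _ => (1 : ℝ)) a) ≤ τ) (hτ2 : τ ≤ 1 / 2) (W : (LandauFree H → E3) → ℝ)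
    {F G : (LandauFree H → E3) → ℝ} {B S : ℝ} (hB : 0 ≤ B) (hS : 0 ≤ S) (mF : Measurable F) (mG : Measurable G) (mW : Measurable W)
    (bF : ∀ a ∈ D, |F a| ≤ B) (bG : ∀ a ∈ D, |G a| ≤ B) (bW : ∀ a ∈ D, |W a| ≤ B) (sW : ∀ a ∈ D, |W a| ≤ S) (a₁ b : ℝ) :
    |Tilt.tiltCum3 ((((volume : Measure (LandauFree H → E3)).restrict D).withDensity fun a => ENNReal.ofReal (gaussWeight β H a))) W 0 F G| ≤
      2 * S * Real.sqrt (2 * gaussAvg β H (fun a => D.indicator (fun _ => (1 : ℝ)) a * (F a - a₁) ^ 2)) *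
        Real.sqrt (2 * gaussAvg β H (fun a => D.indicator (fun _ => (1 : ℝ)) a * (G a - b) ^ 2)) := by
  rw [tiltCum3_zero_eq_triple _ W W F G]
  set μD : Measure (LandauFree H → E3) := (((volume : Measure (LandauFree H → E3)).restrict D).withDensity fun a => ENNReal.ofReal (gaussWeight β H a))
    with hμD
  have e : (fun x => (F x - Tilt.tiltExp μD W 0 F) * (G x - Tilt.tiltExp μD W 0 G) * (W x - Tilt.tiltExp μD W 0 W)) =
      fun x => (W x - Tilt.tiltExp μD W 0 W) * (F x - Tilt.tiltExp μD W 0 F) * (G x - Tilt.tiltExp μD W 0 G) := funext fun x => by ring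
  rw [e]
  exact abs_tiltExp_muSet_zero_centred3_le_of_sup hβ hDm hτ hτ2 W hB hS mW mF mG bW bF bG sW a₁ b

end GaussRestrict

end Summit.QuantumFields.YangMills.Theorems.AllWindowsColdBoxBoxHighLine

end
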